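import Mathlib
import HarnessLib
import Summits.FinalStateConjecture.Statement
import Literature.Geometry.Lorentzian.FinalEraPackage2

/-!
# Route DissipativeFinalMotions — the Assembly re-typed for the T2 summit statement, frame form (item stmt-FinalStateConjecture-17644)

The assembly item of route `DissipativeFinalMotions` ("no eternal loitering — dissipative `N`-body
modulation") for the Final State Conjecture is, since the route's rev 3 (2026-08-16, route-repair after
the summit statement re-type T2, p126844), the UNCURRIED frame statement

`FinalEraGeneric ∧ RadiativeLyapunovBudget ∧ DispersalFromBudget ∧ DispersingCapture → FinalStateConjecture`,

literally "thesis `X` → Statement": G = `FinalEraGeneric` (TAME-Christodoulou-generically on the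
admissible vacuum data — `IsTameChristodoulouGeneric … 1`, the re-typed Statement's notion — an MGHD
exists, and every MGHD has complete `𝓘⁺` and a final era: the 31-clause rev-2 package
`CauchyDevelopment.IsFinalEra₂` of `Literature/Geometry/Lorentzian/FinalEraPackage2.lean` together with
the three rest-frame orientation clauses (R) `RaysStayInClosure`, (F) eventual future-orientation of every
hole chart on every truncated slab, (F₀) eventual future-orientation of the flat chart far from the
holes), B = `RadiativeLyapunovBudget` (every rev-2 era — stated through the INLINE 31-clause chain, which
`IsFinalEra₂` equals by `Iff.rfl` — carries `E : ℝ → ℝ` antitone and bounded below on `[T, ∞)` that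
drops by `ε(D) > 0` within a lag `L(D)` whenever two distinct labels stay `D`-close for one unit of
time), S = `DispersalFromBudget` (real analysis: such a budget and the Lipschitz speed clause force
`‖ξᵢ(t) − ξⱼ(t)‖ → ∞` for `i ≠ j`; PROVED, p99650) and C = `DispersingCapture` (a rev-2 era with (R),
(F), (F₀) whose labels pairwise disperse yields the re-typed Statement's conclusion for that development:
a `C²` final-state decomposition `d` of some `O'` with sub-extremal holes, `O' = exteriorOf 𝒟 d.charted`,
`RaysStayInClosure 𝒟 O'`, `HasExhaustiveCharts d`, `IsFutureOriented d`).

The rev-2 (curried) predecessor stmt-FinalStateConjecture-10157 was proved by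
`Theorems/DissipativeFinalMotionsAssembly.lean` (`DissipativeFinalMotions.assembly_proof`, bodies inlined
against the OLD Statement: plain `IsChristodoulouGeneric`, no (R)/(F)/(F₀), old conclusion); that landed
statement is obsolete after the re-type and Theorems files are append-only, so this module restates the
frame under a NEW name (pattern `Theorems/BurnettKineticRigidityAssemblyT2.lean`,
`Theorems/PhotonSphereChannelsAssemblyFrameT2.lean`).

Design constraint (why this file does NOT import the route module
`Summits.FinalStateConjecture.FinalStateConjecture.Theses.DissipativeFinalMotions`): when an item closes,
the gate re-renders the route file with `import <closing module>` and
`theorem Assembly_holds : Assembly := …`; a closing module that itself imports the route module turns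
that render into an import cycle (the EIHFluxBalance rev-3 and PhotonSphereChannels rev-3/4/6 episodes of
this summit). So the theorem below states the four hypotheses INLINED VERBATIM (the bodies of
`FinalEraGeneric`, `RadiativeLyapunovBudget`, `DispersalFromBudget` and `DispersingCapture`, copied
mechanically from the route file rev 4 of 2026-08-16T23:48Z, one physical line each, elaborated under the
route file's `open` lines and imports), so that its type is the route decl
`Summit.FinalStateConjecture.FinalStateConjecture.Theses.DissipativeFinalMotions.Assembly` by
`δ`-unfolding alone, and the route file can import this module without a cycle.

The proof is pure logic — the body of the route's sorry-free deciding theorem `closes` (rev 3b), which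
proves this very frame inline (`have hA : Assembly := …`) and applies it: tame Christodoulou genericity
`IsTameChristodoulouGeneric 𝓓 P 1 = HasTameCodimAtLeastIn 𝓓 {d ∈ 𝓓 | ¬ P d} 1` is monotone in the
property `P` under pointwise implication on `𝓓` (the witnessing end, family, tameness and immersion are
kept; only the exceptional-set membership is transported), and pointwise on an admissible datum and a
maximal development G's package is fed to B (the budget `E`), the budget and the package's Lipschitz
speed clause (conjunct 14) to S (pairwise dispersal), and package + (R), (F), (F₀) + dispersal to C,
whose conclusion is verbatim the re-typed Statement's clause. No analysis, no new definitions; nothing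
here bears on the truth of G, B or C.
-/

-- every `Summit.FinalStateConjecture.FinalStateConjecture.…` name repeats the summit = sub-problem
-- segment (D-0017 layout, CONVENTIONS §2; the lakefile sets this option for the library build, a
-- standalone elaboration of this file does not see it); the duplicate is deliberate.
set_option linter.dupNamespace false

namespace Summit.FinalStateConjecture.FinalStateConjecture.Theorems

open scoped BigOperators Topology Manifold Classical MeasureTheory ProbabilityTheory Matrix InnerProductSpace ComplexConjugate ContinuousMap
open Filter Set Function TopologicalSpace MeasureTheory

/-- **Assembly of route DissipativeFinalMotions re-typed for the T2 summit statement, frame form** (item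
stmt-FinalStateConjecture-17644, route rev 3): `(G ∧ B ∧ S ∧ C) → FinalStateConjecture` with G =
`FinalEraGeneric` (tame-generically an MGHD exists and every MGHD has complete `𝓘⁺` and a rev-2 final era
`IsFinalEra₂` with the orientation clauses (R), (F), (F₀)), B = `RadiativeLyapunovBudget` (every rev-2
era, inline 31-clause form, carries an antitone bounded-below budget `E` on `[T, ∞)` taxed by `ε(D) > 0`
within lag `L(D)` by every `D`-close unit of time of two distinct labels), S = `DispersalFromBudget`
(such a budget plus the Lipschitz speed clause forces pairwise dispersal) and C = `DispersingCapture` (a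
dispersing oriented rev-2 era yields the re-typed Statement's conclusion for that development), all four
written out verbatim so that this type unfolds to the route decl
`Summit.FinalStateConjecture.FinalStateConjecture.Theses.DissipativeFinalMotions.Assembly` by
`δ`-reduction alone. Proof (the inline `hA` of the route's deciding theorem `closes`): tame genericity is
monotone in the property; pointwise on an admissible datum and a maximal development, G's package gives
B's budget (`IsFinalEra₂` is by `Iff.rfl` B's inline hypothesis, `exteriorOf` unfolded), the budget and
the package's Lipschitz clause (conjunct 14) give dispersal by S, and package + (R), (F), (F₀) + dispersal
give the Statement's clause by C. [folklore] -/
theorem DissipativeFinalMotions.assemblyT2_frame_proof :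
    (∀ (X : Type) [TopologicalSpace X] [ChartedSpace (EuclideanSpace ℝ (Fin 3)) X] [IsManifold (𝓡 3) ((⊤ : ℕ∞) : WithTop ℕ∞) X] [T2Space X] [SecondCountableTopology X] [ConnectedSpace X], Literature.Geometry.Lorentzian.InitialDataSet.IsTameChristodoulouGeneric (Literature.Geometry.Lorentzian.admissibleVacuumData X) (fun D ↦ (∃ 𝒟 : Literature.Geometry.Lorentzian.VacuumCauchyDevelopment D, 𝒟.IsMaximal) ∧ ∀ 𝒟 : Literature.Geometry.Lorentzian.VacuumCauchyDevelopment D, 𝒟.IsMaximal → Summit.FinalStateConjecture.HasCompleteNullInfinity 𝒟.toCauchyDevelopment ∧ ∃ (N : ℕ) (M a : Fin N → ℝ) (T δ V C₁ C₂ ρ₀ κ : ℝ) (ξ : Fin N → ℝ → EuclideanSpace ℝ (Fin 3)) (β : ℝ → ℝ) (U₀ : Opens Literature.Geometry.Lorentzian.E4) (B₀ : Literature.Geometry.Lorentzian.ModelBackground) (B : Fin N → Literature.Geometry.Lorentzian.ModelBackground) (Ψ₀ : B₀.domain → 𝒟.carrier) (Ψ : (i : Fin N) → (B i).domain → 𝒟.carrier)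 (O : Set 𝒟.carrier), 𝒟.toCauchyDevelopment.IsFinalEra₂ N M a T δ V C₁ C₂ ρ₀ κ ξ β U₀ B₀ B Ψ₀ Ψ O ∧ Summit.FinalStateConjecture.RaysStayInClosure 𝒟.toCauchyDevelopment O ∧ (∀ i (ρ : ℝ), ∀ᶠ τ in atTop, ∀ x ∈ (B i).truncTimeSlab ρ τ, 𝒟.toSpacetime.timeOrientation.IsFutureDirected (mfderiv 𝓘(ℝ, Literature.Geometry.Lorentzian.E4) (𝓡 4) (Ψ i) x (Literature.Geometry.Lorentzian.Kerr.timeVector (M i) (a i) x.1))) ∧ (∃ ϱ₀ : ℝ, ∀ᶠ τ in atTop, ∀ x ∈ B₀.timeSlab τ, (∀ i, ϱ₀ ≤ ‖Literature.Geometry.Lorentzian.E4.spatial x.1 - ξ i τ‖) → 𝒟.toSpacetime.timeOrientation.IsFutureDirected (mfderiv 𝓘(ℝ, Literature.Geometry.Lorentzian.E4) (𝓡 4) Ψ₀ x (Literature.Geometry.Lorentzian.E4.basisVector 0)))) 1) ∧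
    (∀ (X : Type) [TopologicalSpace X] [ChartedSpace (EuclideanSpace ℝ (Fin 3)) X] [IsManifold (𝓡 3) ((⊤ : ℕ∞) : WithTop ℕ∞) X] [T2Space X] [SecondCountableTopology X] [ConnectedSpace X], ∀ (D : Literature.Geometry.Lorentzian.InitialDataSet (𝓡 3) X), D ∈ Literature.Geometry.Lorentzian.admissibleVacuumData X → ∀ (𝒟 : Literature.Geometry.Lorentzian.VacuumCauchyDevelopment D), 𝒟.IsMaximal → Summit.FinalStateConjecture.HasCompleteNullInfinity 𝒟.toCauchyDevelopment → ∀ (N : ℕ) (M a : Fin N → ℝ) (T δ V C₁ C₂ ρ₀ κ : ℝ) (ξ : Fin N → ℝ → EuclideanSpace ℝ (Fin 3)) (β : ℝ → ℝ) (U₀ : Opens Literature.Geometry.Lorentzian.E4) (B₀ : Literature.Geometry.Lorentzian.ModelBackground) (B : Fin N → Literature.Geometry.Lorentzian.ModelBackground) (Ψ₀ : B₀.domain → 𝒟.carrier) (Ψ : (i : Fin N) → (B i).domain → 𝒟.carrier) (O : Set 𝒟.carrier), O = Summit.FinalStateConjecture.exteriorOf 𝒟.toCauchyDevelopment (Ψ₀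 '' B₀.lateRegion T ∪ ⋃ i, Ψ i '' (B i).lateRegion T) ∧ B₀ = Literature.Geometry.Lorentzian.Minkowski.backgroundOn U₀ ∧ (B = fun i ↦ Literature.Geometry.Lorentzian.Kerr.background (M i) (a i)) ∧ (∀ i, Literature.Geometry.Lorentzian.Kerr.IsSubextremal (M i) (a i)) ∧ 0 < δ ∧ 0 ≤ V ∧ V < 1 ∧ 0 ≤ C₁ ∧ 1 ≤ C₂ ∧ 0 < ρ₀ ∧ 0 ≤ κ ∧ (∀ i, ContDiff ℝ 2 (ξ i)) ∧ (∀ t, T ≤ t → ∀ i j, i ≠ j → δ ≤ ‖ξ i t - ξ j t‖) ∧ (∀ i s t, T ≤ s → s ≤ t → ‖ξ i t - ξ i s‖ ≤ V * (t - s)) ∧ IntegrableOn β (Ici T) ∧ (∀ t, T ≤ t → 0 ≤ β t) ∧ (∀ t, T ≤ t → ∀ i, ‖deriv (deriv (ξ i)) t + ∑ j ∈ Finset.univ.erase i, (M j / ‖ξ i t - ξ j t‖ ^ 3) • (ξ i t - ξ j t)‖ ≤ κ * (∑ j ∈ Finset.univ.erase i, M j / ‖ξ i t - ξ j t‖ ^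 2 * (‖deriv (ξ i) t‖ ^ 2 + ‖deriv (ξ j) t‖ ^ 2 + (∑ l, M l) / ‖ξ i t - ξ j t‖)) + β t) ∧ 𝒟.toSpacetime.IsLateChart B₀ O T Ψ₀ ∧ {y : Literature.Geometry.Lorentzian.E4 | T < y 0 ∧ ∀ i, ρ₀ < ‖Literature.Geometry.Lorentzian.E4.spatial y - ξ i (y 0)‖} ⊆ (B₀.domain : Set Literature.Geometry.Lorentzian.E4) ∧ (∀ ε : ℝ, 0 < ε → ∃ ϱ T' : ℝ, ∀ τ, T' ≤ τ → Literature.Geometry.Lorentzian.supCkENorm (Subtype.val '' {y : B₀.domain | y.1 0 = τ ∧ ∀ i, ϱ ≤ ‖Literature.Geometry.Lorentzian.E4.spatial y.1 - ξ i τ‖}) 2 (𝒟.toSpacetime.deviationExtend B₀ Ψ₀) ≤ ENNReal.ofReal ε) ∧ (∀ i, 𝒟.toSpacetime.IsLateChart (B i) O T (Ψ i)) ∧ (∀ i (m : ℕ) (x : (B i).domain), m ≤ 2 → T ≤ x.1 0 → (B i).radius x.1 ≤ 2 * ρ₀ → ‖iteratedFDeriv ℝ m (𝒟.toSpacetime.deviationExtend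 (B i) (Ψ i)) x.1‖ ≤ 1 / (100 * M i ^ m)) ∧ (∀ i (R ε : ℝ), 0 < ε → ∃ D' : ℝ, ∀ T' : ℝ, (∀ t, T' ≤ t → ∀ j, j ≠ i → D' ≤ ‖ξ i t - ξ j t‖) → ∃ T'' : ℝ, ∀ τ, T'' ≤ τ → 𝒟.toSpacetime.truncDeviationCk (B i) (Ψ i) 2 R τ ≤ ENNReal.ofReal ε) ∧ (∀ i j, i ≠ j → Ψ i '' (B i).lateRegion T ∩ Ψ j '' (B j).lateRegion T ⊆ range Ψ₀) ∧ (∀ i (x : (B i).domain) (y : B₀.domain), T < x.1 0 → Ψ i x = Ψ₀ y → ‖Literature.Geometry.Lorentzian.E4.spatial y.1 - ξ i (y.1 0)‖ ≤ C₂ * (B i).radius x.1 + C₁) ∧ (∀ i (R : ℝ), ∃ T₃ : ℝ, ∀ y : B₀.domain, T₃ < y.1 0 → ‖Literature.Geometry.Lorentzian.E4.spatial y.1 - ξ i (y.1 0)‖ ≤ R → ∃ x : (B i).domain, Ψ i x = Ψ₀ y ∧ T < x.1 0 ∧ (B i).radius x.1 ≤ C₂ * R + C₁) ∧ (∀ i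 (t₀ : ℝ), ∃ τ' : ℝ, Ψ i '' (B i).lateRegion τ' ∩ Ψ₀ '' {y : B₀.domain | y.1 0 ≤ t₀} = ∅) ∧ (∀ i (τ' R : ℝ), ∃ t₀ : ℝ, Ψ₀ '' {y : B₀.domain | t₀ < y.1 0} ∩ Ψ i '' {x : (B i).domain | x.1 0 ≤ τ' ∧ (B i).radius x.1 ≤ R} = ∅) ∧ (∀ τ₁, T < τ₁ → O \ (Ψ₀ '' B₀.lateRegion τ₁ ∪ ⋃ i, Ψ i '' (B i).truncLateRegion τ₁ (2 * ρ₀)) ⊆ 𝒟.toSpacetime.metric.causalPast 𝒟.toSpacetime.timeOrientation (Ψ₀ '' B₀.timeSlab τ₁ ∪ ⋃ i, Ψ i '' (B i).truncTimeSlab (2 * ρ₀) τ₁)) ∧ Pairwise (Disjoint on fun i ↦ Ψ i '' (B i).truncLateRegion T (2 * ρ₀)) ∧ (∀ i, Literature.Geometry.Lorentzian.Kerr.rPlus (M i) (a i) < ρ₀) → ∃ E : ℝ → ℝ, AntitoneOn E (Ici T) ∧ BddBelow (E '' Ici T) ∧ (∀ D' : ℝ, 0 < D' → ∃ ε L : ℝ,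 0 < ε ∧ 0 ≤ L ∧ ∀ t, T ≤ t → ∀ i j, i ≠ j → (∀ s, t ≤ s → s ≤ t + 1 → ‖ξ i s - ξ j s‖ ≤ D') → E (t + L) ≤ E t - ε)) ∧
    (∀ (N : ℕ) (T V : ℝ) (ξ : Fin N → ℝ → EuclideanSpace ℝ (Fin 3)) (E : ℝ → ℝ), (∀ i s t, T ≤ s → s ≤ t → ‖ξ i t - ξ i s‖ ≤ V * (t - s)) → AntitoneOn E (Ici T) → BddBelow (E '' Ici T) → (∀ D' : ℝ, 0 < D' → ∃ ε L : ℝ, 0 < ε ∧ 0 ≤ L ∧ ∀ t, T ≤ t → ∀ i j, i ≠ j → (∀ s, t ≤ s → s ≤ t + 1 → ‖ξ i s - ξ j s‖ ≤ D') → E (t + L) ≤ E t - ε) → (∀ i j, i ≠ j → Tendsto (fun t ↦ ‖ξ i t - ξ j t‖) atTop atTop)) ∧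
    (∀ (X : Type) [TopologicalSpace X] [ChartedSpace (EuclideanSpace ℝ (Fin 3)) X] [IsManifold (𝓡 3) ((⊤ : ℕ∞) : WithTop ℕ∞) X] [T2Space X] [SecondCountableTopology X] [ConnectedSpace X], ∀ (D : Literature.Geometry.Lorentzian.InitialDataSet (𝓡 3) X), D ∈ Literature.Geometry.Lorentzian.admissibleVacuumData X → ∀ (𝒟 : Literature.Geometry.Lorentzian.VacuumCauchyDevelopment D), 𝒟.IsMaximal → Summit.FinalStateConjecture.HasCompleteNullInfinity 𝒟.toCauchyDevelopment → ∀ (N : ℕ) (M a : Fin N → ℝ) (T δ V C₁ C₂ ρ₀ κ : ℝ) (ξ : Fin N → ℝ → EuclideanSpace ℝ (Fin 3)) (β : ℝ → ℝ) (U₀ : Opens Literature.Geometry.Lorentzian.E4) (B₀ : Literature.Geometry.Lorentzian.ModelBackground) (B : Fin N → Literature.Geometry.Lorentzian.ModelBackground) (Ψ₀ : B₀.domain → 𝒟.carrier) (Ψ : (i : Fin N) → (B i).domain → 𝒟.carrier) (O : Set 𝒟.carrier), 𝒟.toCauchyDevelopment.IsFinalEra₂ N M a T δ V C₁ C₂ ρ₀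 κ ξ β U₀ B₀ B Ψ₀ Ψ O → Summit.FinalStateConjecture.RaysStayInClosure 𝒟.toCauchyDevelopment O → (∀ i (ρ : ℝ), ∀ᶠ τ in atTop, ∀ x ∈ (B i).truncTimeSlab ρ τ, 𝒟.toSpacetime.timeOrientation.IsFutureDirected (mfderiv 𝓘(ℝ, Literature.Geometry.Lorentzian.E4) (𝓡 4) (Ψ i) x (Literature.Geometry.Lorentzian.Kerr.timeVector (M i) (a i) x.1))) → (∃ ϱ₀ : ℝ, ∀ᶠ τ in atTop, ∀ x ∈ B₀.timeSlab τ, (∀ i, ϱ₀ ≤ ‖Literature.Geometry.Lorentzian.E4.spatial x.1 - ξ i τ‖) → 𝒟.toSpacetime.timeOrientation.IsFutureDirected (mfderiv 𝓘(ℝ, Literature.Geometry.Lorentzian.E4) (𝓡 4) Ψ₀ x (Literature.Geometry.Lorentzian.E4.basisVector 0))) → (∀ i j, i ≠ j → Tendsto (fun t ↦ ‖ξ i t - ξ j t‖) atTop atTop) → ∃ (O' : Set 𝒟.carrier) (d : Literature.Geometry.Lorentzian.FinalStateDecomposition 𝒟.toSpacetime O' 2), (∀ i, Literature.Geometry.Lorentzian.Kerr.IsSubextremal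 (d.mass i) (d.spin i)) ∧ O' = Summit.FinalStateConjecture.exteriorOf 𝒟.toCauchyDevelopment d.charted ∧ Summit.FinalStateConjecture.RaysStayInClosure 𝒟.toCauchyDevelopment O' ∧ Summit.FinalStateConjecture.HasExhaustiveCharts d ∧ Summit.FinalStateConjecture.IsFutureOriented d) →
    _root_.FinalStateConjecture := by
  rintro ⟨h₃, h₁, h₂, h₄⟩ X _ _ _ _ _ _
  -- tame Christodoulou genericity (codimension 1, curve form, one fixed end) is monotone in the
  -- property under pointwise implication on 𝓓: end, family, tameness and immersion are kept verbatim
  have mono : ∀ {P Q : Literature.Geometry.Lorentzian.InitialDataSet (𝓡 3) X → Prop},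
      Literature.Geometry.Lorentzian.InitialDataSet.IsTameChristodoulouGeneric
          (Literature.Geometry.Lorentzian.admissibleVacuumData X) P 1 →
        (∀ D ∈ Literature.Geometry.Lorentzian.admissibleVacuumData X, P D → Q D) →
          Literature.Geometry.Lorentzian.InitialDataSet.IsTameChristodoulouGeneric
            (Literature.Geometry.Lorentzian.admissibleVacuumData X) Q 1 := by
    intro P Q h hPQ d hd
    obtain ⟨e, F, hF, himm, h0, hinj, hDF, hE⟩ := h d ⟨hd.1, fun hP ↦ hd.2 (hPQ d hd.1 hP)⟩
    exact ⟨e, F, hF, himm, h0, hinj, hDF,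
      fun c hc hc' ↦ hE c hc ⟨hc'.1, fun hP ↦ hc'.2 (hPQ _ hc'.1 hP)⟩⟩
  refine mono (h₃ X) fun D hD hQD ↦ ⟨hQD.1, fun 𝒟 hmax ↦ ?_⟩
  obtain ⟨hscri, N, M, a, T, δ, V, C₁, C₂, ρ₀, κ, ξ, β, U₀, B₀, B, Ψ₀, Ψ, O, hera, hrays, hholes,
    hflat⟩ := hQD.2 𝒟 hmax
  refine ⟨hscri, ?_⟩
  -- the 31-clause package `IsFinalEra₂` is by definition the inline hypothesis of the budget item
  obtain ⟨E, hanti, hbdd, hcoer⟩ :=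
    h₁ X D hD 𝒟 hmax hscri N M a T δ V C₁ C₂ ρ₀ κ ξ β U₀ B₀ B Ψ₀ Ψ O hera
  -- dispersal from the budget and the Lipschitz speed clause (conjunct 14 of the package)
  have hdisp := h₂ N T V ξ E hera.2.2.2.2.2.2.2.2.2.2.2.2.2.1 hanti hbdd hcoer
  -- capture of the dispersing, oriented era is verbatim the Statement's clause
  exact h₄ X D hD 𝒟 hmax hscri N M a T δ V C₁ C₂ ρ₀ κ ξ β U₀ B₀ B Ψ₀ Ψ O hera hrays hholes hflat
    hdisp

end Summit.FinalStateConjecture.FinalStateConjecture.Theorems
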